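import Mathlib.MeasureTheory.Measure.Hausdorff
import Literature.Analysis.FluidPDE.Seregin2020SingularSetAxis
import Literature.Analysis.FluidPDE.CKNTheoremB
import Literature.Analysis.FluidPDE.ESSLocalHolderNoConcentration
import Literature.Analysis.FluidPDE.KNSSNoAxisymmetricTypeIHolds
import Literature.Analysis.FluidPDE.Seregin2022LogSwirlCriterion
import HarnessLib

/-!
# Seregin 2022, proof of Thm. 1.2 — proved steps (II): Step 1, the regular points that carry
# the cut-off (top-time partial regularity on the axis, singularity-free slabs)

Analysis/FluidPDE proof file (theorems only; no definitions, no named facts, no `sorry`), second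
file on the discharge path of the named fact
`Literature.Analysis.FluidPDE.seregin2022_logSwirl_regularAtOrigin`
(`Seregin2022LogSwirlCriterion.lean`; G. Seregin, J. Math. Fluid Mech. 24 (2022), Paper No. 27 =
arXiv:2201.00153, Thm. 1.2 run from (2.2)), after `Seregin2022LogSwirlCriterionProofs.lean`
(Lemma 2.2).  It proves the inputs of

> **Step 1. Construction of a cut-off function.** The partial regularity theory for the
> Navier–Stokes equations implies that if singular points of an axisymmetric velocity field `v`
> exist, they must belong to the axis of symmetry … Since the 1D parabolic Hausdorff measure of
> the set of singular points is equal to zero, there exist at least two regular points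
> `z₁ = (x', x₃, t) = (0, h₁, 0)` and `z₂ = (0, -h₂, 0)` of `v` such that `0 < h₁, h₂ < 1`.
> According to the properties of regular points, there are cylinders `Q₁ = Q(z₁, δ)` and
> `Q₂ = Q(z₂, δ)` with radius `δ > 0` such that `v ∈ C([-δ², 0]; C³(𝒞̄((0, h₁), δ))) ∩ …` at least.
> Moreover, one can find `t₀ ∈ ]-δ², 0[` such that there is no singular point in the set
> `𝒞̄(r₀) × [t₀, t₀ + δ₀²]` … with `0 < r₀ < 1` and `δ₀ > 0`.

for the class of the fact (Def. 1.1 in `Q = 𝒞 × ]-1, 0[`: `IsSuitableWeakSolutionOn (parCylOpens 0 1) 1 0`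
plus the global classes `v ∈ L_{2,∞}(Q)`, `∇v = G ∈ L₂(Q)`, `q ∈ L_{3/2}(Q)`; no axial symmetry is
needed in this file).

**The point that needs proof.** The regular points `z₁, z₂` sit at the TOP time `t = 0`, which is
not a point of the open region `Q`; the tree's Caffarelli–Kohn–Nirenberg theorem
(`ckn_partial_regularity_holds`, singular set `⊆ Q`, centred cylinders) says nothing there, while
Seregin's statement is `𝒫¹(Σ ∩ (𝒞 × ]-1, 0])) = 0` with BACKWARD cylinders `Q(z, r)` (his
Def. of regular point, Lecture Notes 2014, Ch. 6).  The top slice is handled here by running the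
CKN covering argument at `t = 0` with the backward multi-scale dissipation criterion:

* `Seregin2022.exists_backward_epsilon` — **backward ε-regularity at an arbitrary point**: there is
  a universal `ε > 0` such that, for `(v, q)` of the class in `Q`, a point `z₁` and a radius `R`
  with `Q(z₁, R) ⊆ Q` and `r⁻¹ ∫∫_{Q(z₁, r)} |∇v|² ≤ ε` for all `0 < r < R`, the field `v` is
  essentially bounded on some `Q(z₁, ϱ)` (Seregin 2014, Ch. 6, Thm. 1.4 = `seregin2014_thm14_holds`,
  applied to the pair zoomed from `Q(z₁, R)` to `Q(0, 1)`; the zoom bookkeeping is that of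
  `Seregin2020.offAxis_regular`, minus the rotation packing);
* `Seregin2022.isParabolicNull_top_notRegular` — **the non-regular TOP points `(0, x)`, `x ∈ 𝒞`,
  form a `𝒫¹`-null set**: at such a point the dissipation is above `ε r` on arbitrarily small
  `Q(z, r) = Q*_r(z) ∩ Q`, so the Vitali covering estimate of CKN §6 / RRS (16.21)
  (`parabolicHausdorff_one_le_of_frequently`) inside the slab `]-τ, τ[ × 𝒞` bounds the `𝒫¹`-measure
  by `5ε⁻¹ ∫∫_{]-τ,0[×𝒞} |∇v|²`, which tends to `0` with `τ` (`Seregin2020.exists_tail_lt`);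
* `Seregin2022.ae_top_axisPoint_regular`, `Seregin2022.exists_top_axisPoint_regular_in` — hence
  (the height `z ↦ x₃` being `1`-Lipschitz and `ℋ¹ ≤ 𝒫¹`-null, `ℋ¹ = volume` on `ℝ`) for a.e.
  `h ∈ ]-1, 1[`, in particular for some `h` in any subinterval, the axis point `(0, h e₃)` at
  `t = 0` is regular: `v ∈ L_∞(Q((0, h e₃), ϱ))` for some `ϱ > 0` — the points `z₁, z₂`;
* `Seregin2022.exists_smooth_representative` — "according to the properties of regular points":
  on such a backward cylinder `v` has a representative with `C^∞` slices all of whose spatial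
  derivatives are Hölder continuous on every smaller `Q(z₁, r)`, up to the top time
  (`NSBoundedHigherRegularity_holds`, Seregin–Šverák 2009 §2);
* `Seregin2022.ae_forall_isRegularPoint_parCyl`, `Seregin2022.exists_regular_slab`,
  `Seregin2022.exists_regular_slab_in` — **the singularity-free slab**: a.e. time `t ∈ ]-1, 0[` carries
  only regular points of `Q` (CKN + the null time projection
  `volume_image_fst_eq_zero_of_isParabolicNull`), and a compact regular slice `{t₁} × K` thickens to a
  regular slab `[t₁ - δ, t₁ + δ] × K` (the regular set is open, `isOpen_setOf_isRegularPoint_holds`,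
  and the tube lemma); so every time interval `]a, b[ ⊆ ]-1, 0[` contains a `t₁` with a regular slab
  over any compact `K ⊆ 𝒞` — Seregin's `𝒞̄(r₀) × [t₀, t₀ + δ₀²]`.

Not here (later files): the facts that singular points lie on the axis (in tree:
`Seregin2020.offAxis_regular`, `Seregin2020.singularSet_subset_axis`), (2.1) ⇒ (2.2), and the
classical-in-time status of `v` on singularity-free regions.

## Mathlib / tree search

Tree (all used): `seregin2014_thm14_holds`, `IsSuitableWeakSolutionInBall.zoom`, `stPull`,
`cknE_nsZoom`, `eLpNorm_top_nsZoom`, `zoom_stPreimage_parabolicCylinderOpens`,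
`memLp_threeHalves_of_lintegral_le`, `Seregin2020.exists_tail_lt` (all via
`Seregin2020SingularSetAxis`), `parabolicHausdorff_one_le_of_frequently` (`CKNTheoremB`),
`ckn_partial_regularity_holds`, `isCKNForceOn_zero`, `volume_image_fst_eq_zero_of_isParabolicNull`
(`ESSLocalHolderNoConcentration`), `IsParabolicNull.hausdorffMeasure_eq_zero_holds`,
`isOpen_setOf_isRegularPoint_holds` (`SuitableWeakProofs`), `NSBoundedHigherRegularity_holds`
(`KNSSNoAxisymmetricTypeIHolds`), `SereginSverak2009.parCyl / spaceCyl` and their API.  Mathlib: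
`LipschitzWith.hausdorffMeasure_image_le`, `MeasureTheory.hausdorffMeasure_real`,
`generalized_tube_lemma`, `ENNReal.le_of_forall_pos_le_add`.
`lean search 'top.*notRegular|backward_epsilon|regular_slab'`: nothing before this file; the
interior analogue `ae_forall_isRegularPoint` (`ESSLocalHolderNoConcentration`) is for ball
cylinders `Q(a)`.

## References

* G. Seregin, J. Math. Fluid Mech. 24 (2022), Paper No. 27 = arXiv:2201.00153, §2, Step 1.
  [`Seregin2022LocalAxisym`]
* G. Seregin, *Lecture Notes on Regularity Theory for the Navier–Stokes Equations*, World
  Scientific (2014), Ch. 6, Thm. 1.4 (backward ε-regularity). [`Seregin2014`]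
* L. Caffarelli, R. Kohn, L. Nirenberg, Comm. Pure Appl. Math. 35 (1982), §6 (covering
  argument). [`CaffarelliKohnNirenberg1982`]
* J. C. Robinson, J. L. Rodrigo, W. Sadowski, *The Three-Dimensional Navier–Stokes Equations*,
  CUP (2016), Thm. 16.2, (16.21). [`RobinsonRodrigoSadowski2016`]
-/

noncomputable section

open MeasureTheory Set Function Filter Topology TopologicalSpace Metric
open scoped NNReal ENNReal

namespace Literature.Analysis.FluidPDE

namespace Seregin2022

open SereginSverak2009

variable {u : ℝ → EuclideanSpace ℝ (Fin 3) → EuclideanSpace ℝ (Fin 3)}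
  {p : ℝ → EuclideanSpace ℝ (Fin 3) → ℝ}
  {G : ℝ → EuclideanSpace ℝ (Fin 3) → EuclideanSpace ℝ (Fin 3) →L[ℝ] EuclideanSpace ℝ (Fin 3)}

/-! ### Backward cylinders inside `Q` -/

/-- If `Q(z₁, R) ⊆ Q = 𝒞 × ]-1, 0[` with `R > 0` then its time interval lies in `]-1, 0[`.
[folklore] -/
theorem Ioo_subset_of_parabolicCylinder_subset {z₁ : ℝ × EuclideanSpace ℝ (Fin 3)} {R : ℝ}
    (hR : 0 < R) (hQR : parabolicCylinder R z₁ ⊆ parCyl 0 1) :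
    Ioo (z₁.1 - R ^ 2) z₁.1 ⊆ Ioo (-1 : ℝ) 0 := by
  intro t ht
  have hmem : (t, z₁.2) ∈ parabolicCylinder R z₁ := by
    rw [mem_parabolicCylinder]
    exact ⟨ht, by simpa using hR⟩
  have h1 := (mem_parCyl_zero.1 (hQR hmem)).1
  simpa using h1

/-- If `Q(z₁, R) ⊆ Q = 𝒞 × ]-1, 0[` with `R > 0` then its ball lies in `𝒞`. [folklore] -/
theorem ball_subset_of_parabolicCylinder_subset {z₁ : ℝ × EuclideanSpace ℝ (Fin 3)} {R : ℝ}
    (hR : 0 < R) (hQR : parabolicCylinder R z₁ ⊆ parCyl 0 1) :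
    ball z₁.2 R ⊆ spaceCyl (0 : EuclideanSpace ℝ (Fin 3)) 1 := by
  intro x hx
  have hmem : (z₁.1 - R ^ 2 / 2, x) ∈ parabolicCylinder R z₁ := by
    rw [mem_parabolicCylinder]
    exact ⟨⟨by nlinarith, by nlinarith⟩, mem_ball.1 hx⟩
  exact (hQR hmem).2

/-! ### Backward ε-regularity at an arbitrary point of `𝒞 × ]-1, 0]` -/

/-- **Backward multi-scale ε-regularity at an arbitrary point** (Seregin 2014, Ch. 6, Thm. 1.4,
transported): there is a universal `ε > 0` such that for every pair `(v, q)` of the class of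
Def. 1.1 in `Q = 𝒞 × ]-1, 0[` (suitable weak solution on `Q` plus `v ∈ L_{2,∞}(Q)`,
`∇v = G ∈ L₂(Q)`, `q ∈ L_{3/2}(Q)`), every point `z₁` and radius `R > 0` with `Q(z₁, R) ⊆ Q` and
`r⁻¹ ∫∫_{Q(z₁, r)} |∇v|² ≤ ε` for all `0 < r < R`, the velocity is essentially bounded on some
backward cylinder `Q(z₁, ϱ)`, `ϱ > 0` (so `z₁` may lie on the top `t = 0`).  Proof: the pair zoomed
from `Q(z₁, R)` to `Q(0, 1)` is in Albritton–Barker's class with `sup_{0<r<1} E(r) ≤ ε < 2ε`, and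
`seregin2014_thm14_holds` (with its `ε₀ = 2ε`) bounds it near the vertex; transport back.
[cite: Seregin2014, Ch. 6 §6.1 Thm. 1.4 (PDF p. 94)] -/
theorem exists_backward_epsilon :
    ∃ ε : ℝ, 0 < ε ∧ ∀ {u : ℝ → EuclideanSpace ℝ (Fin 3) → EuclideanSpace ℝ (Fin 3)}
      {p : ℝ → EuclideanSpace ℝ (Fin 3) → ℝ}
      {G : ℝ → EuclideanSpace ℝ (Fin 3) → EuclideanSpace ℝ (Fin 3) →L[ℝ] EuclideanSpace ℝ (Fin 3)},
      IsSuitableWeakSolutionOn (parCylOpens 0 1) 1 0 u p →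
      (∃ C : ℝ≥0, ∀ᵐ t ∂(volume.restrict (Ioo (-1 : ℝ) 0)),
        ∫⁻ x in spaceCyl 0 1, ‖u t x‖ₑ ^ 2 ≤ C) →
      HasWeakSpatialGradientOn (parCylOpens 0 1) u G →
      (∫⁻ z in parCyl 0 1, ENNReal.ofReal (frobeniusNormSq (G z.1 z.2)) < ∞) →
      (∫⁻ z in parCyl 0 1, ‖p z.1 z.2‖ₑ ^ (3 / 2 : ℝ) < ∞) →
      ∀ {z₁ : ℝ × EuclideanSpace ℝ (Fin 3)} {R : ℝ}, 0 < R →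
      parabolicCylinder R z₁ ⊆ parCyl 0 1 →
      (∀ r ∈ Ioo 0 R, (ENNReal.ofReal r)⁻¹ *
        ∫⁻ q in parabolicCylinder r z₁, ENNReal.ofReal (frobeniusNormSq (G q.1 q.2)) ≤
          ENNReal.ofReal ε) →
      ∃ ϱ : ℝ, 0 < ϱ ∧ eLpNorm (uncurry u) ∞ (volume.restrict (parabolicCylinder ϱ z₁)) < ∞ := by
  obtain ⟨ε₀, hε₀, Hreg⟩ := seregin2014_thm14_holds
  refine ⟨ε₀ / 2, by positivity, ?_⟩
  intro u p G hsw hA hG hE hp z₁ R hR hQR hsmall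
  have hR2 : 0 < R ^ 2 := by positivity
  have hleR : parabolicCylinderOpens R z₁ ≤ parCylOpens 0 1 := fun w hw => hQR hw
  have hIsub : Ioo (z₁.1 - R ^ 2) z₁.1 ⊆ Ioo (-1 : ℝ) 0 :=
    Ioo_subset_of_parabolicCylinder_subset hR hQR
  have hBsub : ball z₁.2 R ⊆ spaceCyl (0 : EuclideanSpace ℝ (Fin 3)) 1 :=
    ball_subset_of_parabolicCylinder_subset hR hQR
  -- the pair in Albritton–Barker's class on `Q(z₁, R)`
  have hballR : IsSuitableWeakSolutionInBall R z₁ u p := by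
    refine ⟨hsw.of_le hleR, ?_, ⟨G, hG.mono hleR, (lintegral_mono_set hQR).trans_lt hE⟩, ?_⟩
    · obtain ⟨C, hC⟩ := hA
      refine ⟨C, ?_⟩
      filter_upwards [ae_restrict_of_ae_restrict_of_subset hIsub hC] with t ht
      exact (lintegral_mono_set hBsub).trans ht
    · have hpm : AEStronglyMeasurable (uncurry p) (volume.restrict (parabolicCylinder R z₁)) :=
        hsw.distributional.2.2.1.aestronglyMeasurable.mono_measure
          (Measure.restrict_mono (hQR.trans (subset_of_eq (coe_parCylOpens 0 1).symm)) le_rfl)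
      have hfin : ∫⁻ z in parabolicCylinder R z₁, ‖uncurry p z‖ₑ ^ (3 / 2 : ℝ) ≠ ∞ :=
        ((lintegral_mono_set hQR).trans_lt hp).ne
      exact (memLp_threeHalves_of_lintegral_le hpm hfin le_rfl).1
  -- the rescaled pair on `Q(0, 1)` and its gradient
  have hball1 := hballR.zoom hR
  set G₁ : ℝ → EuclideanSpace ℝ (Fin 3) → EuclideanSpace ℝ (Fin 3) →L[ℝ] EuclideanSpace ℝ (Fin 3) :=
    (R ^ 2) • stPull (R ^ 2) R z₁.1 z₁.2 G with hG₁
  have hG₁w : HasWeakSpatialGradientOn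
      (parabolicCylinderOpens 1 (0 : ℝ × EuclideanSpace ℝ (Fin 3)))
      (R • stPull (R ^ 2) R z₁.1 z₁.2 u) G₁ := by
    have h1 := (hG.mono hleR).stRescale R hR2 hR z₁.1 z₁.2
    rw [zoom_stPreimage_parabolicCylinderOpens hR z₁, ← pow_two] at h1
    exact h1
  have hz₁ : stAffine (R ^ 2) R z₁.1 z₁.2 (0 : ℝ × EuclideanSpace ℝ (Fin 3)) = z₁ :=
    Prod.ext (by simp [stAffine]) (by simp [stAffine])
  -- the dissipation of the rescaled pair is small at all scales
  have hEsmall : ∀ r ∈ Ioo (0 : ℝ) 1,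
      cknE r (0 : ℝ × EuclideanSpace ℝ (Fin 3)) G₁ ≤ ENNReal.ofReal (ε₀ / 2) := by
    intro r hr
    have hRr : 0 < R * r := mul_pos hR hr.1
    have hRr1 : R * r < R := mul_lt_of_lt_one_right hR hr.2
    rw [hG₁, cknE_nsZoom hR hr.1 z₁.1 z₁.2 0 G, hz₁, cknE]
    exact hsmall (R * r) ⟨hRr, hRr1⟩
  have hsup : (⨆ r ∈ Ioo (0 : ℝ) 1, cknE r (0 : ℝ × EuclideanSpace ℝ (Fin 3)) G₁) <
      ENNReal.ofReal ε₀ := by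
    refine lt_of_le_of_lt (iSup₂_le fun r hr => hEsmall r hr) ?_
    exact (ENNReal.ofReal_lt_ofReal_iff hε₀).2 (by linarith)
  -- Seregin's criterion and transport back
  obtain ⟨ϱ, hϱ, hbdd⟩ := Hreg _ _ hball1 ⟨G₁, hG₁w, hsup⟩
  refine ⟨R * ϱ, mul_pos hR hϱ.1, ?_⟩
  have e := eLpNorm_top_nsZoom hR z₁.1 z₁.2 ϱ (0 : ℝ × EuclideanSpace ℝ (Fin 3)) u
  rw [hz₁] at e
  rw [e] at hbdd
  have hR0 : ENNReal.ofReal R ≠ 0 := (ENNReal.ofReal_pos.2 hR).ne'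
  exact lt_of_le_of_lt (by
    calc eLpNorm (uncurry u) ∞ (volume.restrict (parabolicCylinder (R * ϱ) z₁))
        = (ENNReal.ofReal R)⁻¹ * (ENNReal.ofReal R *
            eLpNorm (uncurry u) ∞ (volume.restrict (parabolicCylinder (R * ϱ) z₁))) := by
          rw [← mul_assoc, ENNReal.inv_mul_cancel hR0 ENNReal.ofReal_ne_top, one_mul]
      _ ≤ _ := le_rfl)
    (ENNReal.mul_lt_top (ENNReal.inv_lt_top.2 (ENNReal.ofReal_pos.2 hR)) hbdd)

/-! ### The top slice: non-regular top points form a `𝒫¹`-null set -/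

/-- **The non-regular top points form a `𝒫¹`-null set** (Seregin 2022, Step 1: "the 1D parabolic
Hausdorff measure of the set of singular points is equal to zero", at the top time `t = 0`, which
the interior theorem `ckn_partial_regularity` does not cover).  For `(v, q)` of the class of
Def. 1.1 in `Q`, the set of points `(0, x)`, `x ∈ 𝒞`, at which `v` is NOT essentially bounded on
any backward cylinder `Q((0, x), ϱ)` is `𝒫¹`-null.  Proof: CKN's covering argument (§6) run at the
top with the backward criterion `exists_backward_epsilon` (module docstring).
[cite: Seregin2022LocalAxisym, §2 Step 1; CaffarelliKohnNirenberg1982 §6] -/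
theorem isParabolicNull_top_notRegular
    (hsw : IsSuitableWeakSolutionOn (parCylOpens 0 1) 1 0 u p)
    (hA : ∃ C : ℝ≥0, ∀ᵐ t ∂(volume.restrict (Ioo (-1 : ℝ) 0)),
      ∫⁻ x in spaceCyl 0 1, ‖u t x‖ₑ ^ 2 ≤ C)
    (hG : HasWeakSpatialGradientOn (parCylOpens 0 1) u G)
    (hE : ∫⁻ z in parCyl 0 1, ENNReal.ofReal (frobeniusNormSq (G z.1 z.2)) < ∞)
    (hp : ∫⁻ z in parCyl 0 1, ‖p z.1 z.2‖ₑ ^ (3 / 2 : ℝ) < ∞) :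
    IsParabolicNull 1 {z : ℝ × EuclideanSpace ℝ (Fin 3) | z.1 = 0 ∧
      z.2 ∈ spaceCyl (0 : EuclideanSpace ℝ (Fin 3)) 1 ∧
      ¬ ∃ ϱ : ℝ, 0 < ϱ ∧ eLpNorm (uncurry u) ∞ (volume.restrict (parabolicCylinder ϱ z)) < ∞} := by
  obtain ⟨ε, hε, Hreg⟩ := exists_backward_epsilon
  set f : ℝ × EuclideanSpace ℝ (Fin 3) → ℝ≥0∞ :=
    fun w => ENNReal.ofReal (frobeniusNormSq (G w.1 w.2)) with hf
  set F : ℝ × EuclideanSpace ℝ (Fin 3) → ℝ≥0∞ := (parCyl 0 1).indicator f with hF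
  set Y : Set (ℝ × EuclideanSpace ℝ (Fin 3)) := {z | z.1 = 0 ∧
      z.2 ∈ spaceCyl (0 : EuclideanSpace ℝ (Fin 3)) 1 ∧
      ¬ ∃ ϱ : ℝ, 0 < ϱ ∧ eLpNorm (uncurry u) ∞ (volume.restrict (parabolicCylinder ϱ z)) < ∞}
    with hY
  have hmeasQ : MeasurableSet (parCyl (0 : ℝ × EuclideanSpace ℝ (Fin 3)) 1) :=
    (isOpen_parCyl 0 1).measurableSet
  have hε0 : ENNReal.ofReal ε ≠ 0 := (ENNReal.ofReal_pos.2 hε).ne'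
  -- (i) at points of `Y` the dissipation is frequently above `ε r`
  have hfreq : ∀ z ∈ Y, ∃ᶠ r in 𝓝[>] (0 : ℝ),
      ENNReal.ofReal ε * ENNReal.ofReal r < ∫⁻ w in parabolicCylinderCentered r z, F w := by
    rintro z ⟨hz0, hzC, hzs⟩
    obtain ⟨r₀, hr₀, hball⟩ := Metric.isOpen_iff.1 (isOpen_spaceCyl 0 1) z.2 hzC
    rw [Filter.frequently_iff]
    intro U hU
    obtain ⟨b, hb, hbU⟩ := mem_nhdsGT_iff_exists_Ioo_subset.1 hU
    set R : ℝ := min (min r₀ 1) b with hRdef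
    have hb' : (0 : ℝ) < b := hb
    have hRpos : 0 < R := lt_min (lt_min hr₀ one_pos) hb'
    have hRr₀ : R ≤ r₀ := (min_le_left _ _).trans (min_le_left _ _)
    have hR1 : R ≤ 1 := (min_le_left _ _).trans (min_le_right _ _)
    have hRb : R ≤ b := min_le_right _ _
    -- `Q(z, R) ⊆ Q`
    have hQR : parabolicCylinder R z ⊆ parCyl 0 1 := by
      intro w hw
      rw [mem_parabolicCylinder] at hw
      obtain ⟨⟨hw1, hw2⟩, hw3⟩ := hw
      rw [hz0] at hw1 hw2
      have hwC : w.2 ∈ spaceCyl (0 : EuclideanSpace ℝ (Fin 3)) 1 := hball (lt_of_lt_of_le hw3 hRr₀)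
      refine ⟨⟨?_, ?_⟩, hwC⟩
      · have : R ^ 2 ≤ 1 := by nlinarith
        simp only [Prod.fst_zero]
        linarith
      · simpa using hw2
    by_contra hcon
    refine hzs (Hreg hsw hA hG hE hp hRpos hQR fun r hr => ?_)
    have hrU : r ∈ U := hbU ⟨hr.1, lt_of_lt_of_le hr.2 hRb⟩
    have h1 : ∫⁻ w in parabolicCylinderCentered r z, F w ≤
        ENNReal.ofReal ε * ENNReal.ofReal r := by
      by_contra h2
      exact hcon ⟨r, hrU, not_le.1 h2⟩
    -- `∫_{Q(z,r)} |∇u|² = ∫_{Q*_r(z)} F`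
    have hsub_r : parabolicCylinder r z ⊆ parCyl 0 1 :=
      (parabolicCylinder_mono hr.1.le hr.2.le z).trans hQR
    have hset : parCyl 0 1 ∩ parabolicCylinderCentered r z = parabolicCylinder r z := by
      ext w
      constructor
      · rintro ⟨hwQ, hw⟩
        rw [mem_parabolicCylinder]
        have hwQ' := mem_parCyl_zero.1 hwQ
        refine ⟨⟨hw.1.1, ?_⟩, hw.2⟩
        rw [hz0]
        exact hwQ'.1.2
      · intro hw
        exact ⟨hsub_r hw, parabolicCylinder_subset_centered r z hw⟩
    have e1 : ∫⁻ w in parabolicCylinderCentered r z, F w =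
        ∫⁻ q in parabolicCylinder r z, ENNReal.ofReal (frobeniusNormSq (G q.1 q.2)) := by
      rw [hF, lintegral_indicator hmeasQ, Measure.restrict_restrict hmeasQ, hset]
    rw [← e1]
    have hr0 : ENNReal.ofReal r ≠ 0 := (ENNReal.ofReal_pos.2 hr.1).ne'
    calc (ENNReal.ofReal r)⁻¹ * ∫⁻ w in parabolicCylinderCentered r z, F w
        ≤ (ENNReal.ofReal r)⁻¹ * (ENNReal.ofReal ε * ENNReal.ofReal r) := by gcongr
      _ = ENNReal.ofReal ε := by
          rw [mul_comm (ENNReal.ofReal ε), ← mul_assoc,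
            ENNReal.inv_mul_cancel hr0 ENNReal.ofReal_ne_top, one_mul]
  -- (ii) the covering estimate inside thin slabs `]-τ, τ[ × 𝒞`
  have hbound : ∀ δ : ℝ≥0∞, 0 < δ → parabolicHausdorff 1 Y ≤ 5 * (ENNReal.ofReal ε)⁻¹ * δ := by
    intro δ hδ
    obtain ⟨τ, hτ, htail⟩ := Seregin2020.exists_tail_lt hE 0 hδ
    set V : Set (ℝ × EuclideanSpace ℝ (Fin 3)) :=
      Ioo (-τ) τ ×ˢ spaceCyl (0 : EuclideanSpace ℝ (Fin 3)) 1 with hV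
    have hVo : IsOpen V := isOpen_Ioo.prod (isOpen_spaceCyl 0 1)
    have hYV : Y ⊆ V := by
      rintro z ⟨hz0, hzC, -⟩
      exact ⟨by rw [hz0]; exact ⟨by linarith, hτ⟩, hzC⟩
    have hcov := parabolicHausdorff_one_le_of_frequently (F := F) hVo hYV hε0
      ENNReal.ofReal_ne_top hfreq
    refine hcov.trans ?_
    gcongr
    calc ∫⁻ w in V, F w = ∫⁻ w in parCyl 0 1 ∩ V, f w := by
          rw [hF, lintegral_indicator hmeasQ, Measure.restrict_restrict hmeasQ]
      _ ≤ ∫⁻ w in parCyl 0 1 ∩ Ioo (0 - τ) 0 ×ˢ (univ : Set (EuclideanSpace ℝ (Fin 3))), f w := by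
          refine lintegral_mono_set ?_
          rintro w ⟨hwQ, hwV⟩
          refine ⟨hwQ, ⟨?_, ?_⟩, mem_univ _⟩
          · have := hwV.1.1
            linarith
          · have := (mem_parCyl_zero.1 hwQ).1.2
            simpa using this
      _ = ∫⁻ w in Ioo (0 - τ) 0 ×ˢ (univ : Set (EuclideanSpace ℝ (Fin 3))), F w := by
          rw [hF, lintegral_indicator hmeasQ, Measure.restrict_restrict hmeasQ]
      _ ≤ δ := htail.le
  -- (iii) conclusion
  show parabolicHausdorff 1 Y = 0
  refine le_antisymm ?_ (zero_le)
  refine ENNReal.le_of_forall_pos_le_add fun η hη _ => ?_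
  rw [zero_add]
  set C : ℝ≥0∞ := 5 * (ENNReal.ofReal ε)⁻¹ with hC
  have hC0 : C ≠ 0 := mul_ne_zero (by norm_num) (ENNReal.inv_ne_zero.2 ENNReal.ofReal_ne_top)
  have hCtop : C ≠ ∞ := ENNReal.mul_ne_top (by norm_num) (ENNReal.inv_ne_top.2 hε0)
  have hηpos : (0 : ℝ≥0∞) < (η : ℝ≥0∞) / C :=
    ENNReal.div_pos (by exact_mod_cast hη.ne') hCtop
  calc parabolicHausdorff 1 Y ≤ C * ((η : ℝ≥0∞) / C) := hbound _ hηpos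
    _ = η := ENNReal.mul_div_cancel hC0 hCtop

/-! ### Almost every axis height gives a regular top point -/

/-- **Regular top points on the axis** (Seregin 2022, Step 1: "there exist at least two regular
points `z₁ = (0, h₁, 0)` and `z₂ = (0, -h₂, 0)` of `v` such that `0 < h₁, h₂ < 1`"): for a.e.
height `h` with `|h| < 1`, `v` is essentially bounded on a backward cylinder `Q((0, h e₃), ϱ)`,
`ϱ > 0`, about the axis point `(0, 0, h)` at the top time `t = 0` (the height is `1`-Lipschitz, so
the image of the `𝒫¹`-null, hence `ℋ¹`-null, set of `isParabolicNull_top_notRegular` is Lebesgue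
null). [cite: Seregin2022LocalAxisym, §2 Step 1] -/
theorem ae_top_axisPoint_regular
    (hsw : IsSuitableWeakSolutionOn (parCylOpens 0 1) 1 0 u p)
    (hA : ∃ C : ℝ≥0, ∀ᵐ t ∂(volume.restrict (Ioo (-1 : ℝ) 0)),
      ∫⁻ x in spaceCyl 0 1, ‖u t x‖ₑ ^ 2 ≤ C)
    (hG : HasWeakSpatialGradientOn (parCylOpens 0 1) u G)
    (hE : ∫⁻ z in parCyl 0 1, ENNReal.ofReal (frobeniusNormSq (G z.1 z.2)) < ∞)
    (hp : ∫⁻ z in parCyl 0 1, ‖p z.1 z.2‖ₑ ^ (3 / 2 : ℝ) < ∞) :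
    ∀ᵐ h : ℝ, |h| < 1 → ∃ ϱ : ℝ, 0 < ϱ ∧ eLpNorm (uncurry u) ∞
      (volume.restrict (parabolicCylinder ϱ
        ((0 : ℝ), EuclideanSpace.single (2 : Fin 3) h))) < ∞ := by
  have hY := isParabolicNull_top_notRegular hsw hA hG hE hp
  set Y : Set (ℝ × EuclideanSpace ℝ (Fin 3)) := {z | z.1 = 0 ∧
      z.2 ∈ spaceCyl (0 : EuclideanSpace ℝ (Fin 3)) 1 ∧
      ¬ ∃ ϱ : ℝ, 0 < ϱ ∧ eLpNorm (uncurry u) ∞ (volume.restrict (parabolicCylinder ϱ z)) < ∞}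
    with hYdef
  have h1 : μH[1] Y = 0 := IsParabolicNull.hausdorffMeasure_eq_zero_holds one_pos hY
  set π : ℝ × EuclideanSpace ℝ (Fin 3) → ℝ := fun z => z.2 2 with hπ
  have hπL : LipschitzWith 1 π := by
    refine LipschitzWith.of_dist_le_mul fun z w => ?_
    rw [NNReal.coe_one, one_mul, Real.dist_eq]
    calc |π z - π w| = ‖(z.2 - w.2) 2‖ := by simp [hπ, Real.norm_eq_abs]
      _ ≤ ‖z.2 - w.2‖ := PiLp.norm_apply_le _ _
      _ = dist z.2 w.2 := (dist_eq_norm _ _).symm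
      _ ≤ max (dist z.1 w.1) (dist z.2 w.2) := le_max_right _ _
      _ = dist z w := Prod.dist_eq.symm
  have h2 : μH[1] (π '' Y) ≤ ((1 : ℝ≥0) : ℝ≥0∞) ^ (1 : ℝ) * μH[1] Y :=
    hπL.hausdorffMeasure_image_le zero_le_one Y
  rw [h1, mul_zero, nonpos_iff_eq_zero] at h2
  have hvol : volume (π '' Y) = 0 := by
    rw [← hausdorffMeasure_real]
    exact h2
  rw [ae_iff]
  refine measure_mono_null (fun h hh => ?_) hvol
  simp only [mem_setOf_eq, Classical.not_imp] at hh
  obtain ⟨hh1, hh2⟩ := hh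
  refine ⟨((0 : ℝ), EuclideanSpace.single (2 : Fin 3) h), ⟨rfl, ?_, hh2⟩, by simp [hπ]⟩
  rw [mem_spaceCyl]
  constructor
  · have : cylRadius (EuclideanSpace.single (2 : Fin 3) h - 0) = 0 := by
      rw [cylRadius_eq_zero_iff]
      simp
    rw [this]
    exact one_pos
  · simpa using hh1

/-! ### Almost every time is regular; singularity-free slabs -/

/-- **Almost every time of `Q` is regular**: for a suitable weak solution on `Q = 𝒞 × ]-1, 0[`
(`ν = 1`, no force), for a.e. `t` every point `(t, x) ∈ Q` is a regular point
(Caffarelli–Kohn–Nirenberg `𝒫¹(S) = 0` and the null time projection of `𝒫¹`-null sets).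
[cite: CaffarelliKohnNirenberg1982, Theorem B; Seregin2022LocalAxisym §2 Step 1] -/
theorem ae_forall_isRegularPoint_parCyl
    (hsw : IsSuitableWeakSolutionOn (parCylOpens 0 1) 1 0 u p) :
    ∀ᵐ t : ℝ, ∀ x, (t, x) ∈ parCyl (0 : ℝ × EuclideanSpace ℝ (Fin 3)) 1 →
      IsRegularPoint u (t, x) := by
  have hS : IsParabolicNull 1
      (singularSet u (parCylOpens 0 1 : Set (ℝ × EuclideanSpace ℝ (Fin 3)))) :=
    ckn_partial_regularity_holds (parCylOpens 0 1) one_pos hsw (isCKNForceOn_zero _)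
  have hvol := volume_image_fst_eq_zero_of_isParabolicNull hS
  rw [ae_iff]
  refine measure_mono_null (fun t ht => ?_) hvol
  simp only [mem_setOf_eq, not_forall] at ht
  obtain ⟨x, hx, hreg⟩ := ht
  exact ⟨(t, x), ⟨by rw [coe_parCylOpens]; exact hx, hreg⟩, rfl⟩

/-- **Tube lemma for regular points**: if every point of the compact slice `{t₁} × K` is regular,
so is every point of a slab `[t₁ - δ, t₁ + δ] × K`, `δ > 0` (the regular set is open).
[cite: Seregin2022LocalAxisym, §2 Step 1 (no singular point in 𝒞̄(r₀) × [t₀, t₀ + δ₀²])] -/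
theorem exists_regular_slab {K : Set (EuclideanSpace ℝ (Fin 3))} (hK : IsCompact K) {t₁ : ℝ}
    (hreg : ∀ x ∈ K, IsRegularPoint u (t₁, x)) :
    ∃ δ : ℝ, 0 < δ ∧ ∀ t ∈ Icc (t₁ - δ) (t₁ + δ), ∀ x ∈ K, IsRegularPoint u (t, x) := by
  have hopen : IsOpen {z : ℝ × EuclideanSpace ℝ (Fin 3) | IsRegularPoint u z} :=
    isOpen_setOf_isRegularPoint_holds u
  have hsub : ({t₁} : Set ℝ) ×ˢ K ⊆ {z : ℝ × EuclideanSpace ℝ (Fin 3) | IsRegularPoint u z} := by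
    rintro ⟨t, x⟩ ⟨ht, hx⟩
    rw [mem_singleton_iff] at ht
    subst ht
    exact hreg x hx
  obtain ⟨U, W, hU, -, h1U, hKW, hUW⟩ := generalized_tube_lemma isCompact_singleton hK hopen hsub
  obtain ⟨δ, hδ, hball⟩ := Metric.isOpen_iff.1 hU t₁ (h1U (mem_singleton t₁))
  refine ⟨δ / 2, by positivity, fun t ht x hx => hUW (⟨hball ?_, hKW hx⟩ : (t, x) ∈ U ×ˢ W)⟩
  rw [mem_ball, Real.dist_eq, abs_lt]
  constructor <;> linarith [ht.1, ht.2]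

/-- **The singularity-free slab of Step 1**: for a suitable weak solution on `Q`, a compact
`K ⊆ 𝒞` and a time interval `]a, b[ ⊆ ]-1, 0[`, there are `t₁ ∈ ]a, b[` and `δ > 0` such that every
point of `[t₁ - δ, t₁ + δ] × K` is regular (Seregin: "one can find `t₀ ∈ ]-δ², 0[` such that there is
no singular point in the set `𝒞̄(r₀) × [t₀, t₀ + δ₀²]`"). [cite: Seregin2022LocalAxisym, §2 Step 1] -/
theorem exists_regular_slab_in
    (hsw : IsSuitableWeakSolutionOn (parCylOpens 0 1) 1 0 u p)
    {K : Set (EuclideanSpace ℝ (Fin 3))} (hK : IsCompact K)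
    (hKC : K ⊆ spaceCyl (0 : EuclideanSpace ℝ (Fin 3)) 1)
    {a b : ℝ} (hab : a < b) (ha : -1 ≤ a) (hb : b ≤ 0) :
    ∃ t₁ ∈ Ioo a b, ∃ δ : ℝ, 0 < δ ∧
      ∀ t ∈ Icc (t₁ - δ) (t₁ + δ), ∀ x ∈ K, IsRegularPoint u (t, x) := by
  have hae := ae_forall_isRegularPoint_parCyl hsw
  have hgood : ∃ t₁ ∈ Ioo a b, ∀ x, (t₁, x) ∈ parCyl (0 : ℝ × EuclideanSpace ℝ (Fin 3)) 1 →
      IsRegularPoint u (t₁, x) := by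
    by_contra hcon
    push Not at hcon
    have hsub : Ioo a b ⊆ {t | ¬ ∀ x, (t, x) ∈ parCyl (0 : ℝ × EuclideanSpace ℝ (Fin 3)) 1 →
        IsRegularPoint u (t, x)} := by
      intro t ht
      simp only [mem_setOf_eq, not_forall]
      obtain ⟨x, hx, hr⟩ := hcon t ht
      exact ⟨x, hx, hr⟩
    have h0 : volume (Ioo a b) = 0 := measure_mono_null hsub (ae_iff.1 hae)
    rw [Real.volume_Ioo, ENNReal.ofReal_eq_zero] at h0
    linarith
  obtain ⟨t₁, ht₁, hreg⟩ := hgood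
  have hreg' : ∀ x ∈ K, IsRegularPoint u (t₁, x) := fun x hx => by
    refine hreg x ⟨⟨?_, ?_⟩, hKC hx⟩
    · simp only [Prod.fst_zero]
      linarith [ht₁.1]
    · simp only [Prod.fst_zero]
      linarith [ht₁.2]
  obtain ⟨δ, hδ, hslab⟩ := exists_regular_slab hK hreg'
  exact ⟨t₁, ht₁, δ, hδ, hslab⟩

/-- **Regular top axis points in every height interval**: for `(v, q)` of the class of Def. 1.1 in
`Q` and `-1 ≤ a < b ≤ 1` there is `h ∈ ]a, b[` with `v ∈ L_∞(Q((0, h e₃), ϱ))` for some `ϱ > 0`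
(from `ae_top_axisPoint_regular`: `]a, b[` has positive measure) — the points `z₁ = (0, h₁, 0)`,
`z₂ = (0, -h₂, 0)` of Step 1. [cite: Seregin2022LocalAxisym, §2 Step 1] -/
theorem exists_top_axisPoint_regular_in
    (hsw : IsSuitableWeakSolutionOn (parCylOpens 0 1) 1 0 u p)
    (hA : ∃ C : ℝ≥0, ∀ᵐ t ∂(volume.restrict (Ioo (-1 : ℝ) 0)),
      ∫⁻ x in spaceCyl 0 1, ‖u t x‖ₑ ^ 2 ≤ C)
    (hG : HasWeakSpatialGradientOn (parCylOpens 0 1) u G)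
    (hE : ∫⁻ z in parCyl 0 1, ENNReal.ofReal (frobeniusNormSq (G z.1 z.2)) < ∞)
    (hp : ∫⁻ z in parCyl 0 1, ‖p z.1 z.2‖ₑ ^ (3 / 2 : ℝ) < ∞)
    {a b : ℝ} (hab : a < b) (ha : -1 ≤ a) (hb : b ≤ 1) :
    ∃ h ∈ Ioo a b, ∃ ϱ : ℝ, 0 < ϱ ∧ eLpNorm (uncurry u) ∞
      (volume.restrict (parabolicCylinder ϱ
        ((0 : ℝ), EuclideanSpace.single (2 : Fin 3) h))) < ∞ := by
  have hae := ae_top_axisPoint_regular hsw hA hG hE hp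
  by_contra hcon
  push Not at hcon
  have hsub : Ioo a b ⊆ {h : ℝ | ¬ (|h| < 1 → ∃ ϱ : ℝ, 0 < ϱ ∧ eLpNorm (uncurry u) ∞
      (volume.restrict (parabolicCylinder ϱ
        ((0 : ℝ), EuclideanSpace.single (2 : Fin 3) h))) < ∞)} := by
    intro h hh
    simp only [mem_setOf_eq, Classical.not_imp]
    refine ⟨abs_lt.2 ⟨by linarith [hh.1], by linarith [hh.2]⟩, ?_⟩
    push Not
    exact hcon h hh
  have h0 : volume (Ioo a b) = 0 := measure_mono_null hsub (ae_iff.1 hae)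
  rw [Real.volume_Ioo, ENNReal.ofReal_eq_zero] at h0
  linarith

/-! ### Smoothness near a (top-)regular point -/

/-- **"According to the properties of regular points"** (Seregin 2022, Step 1): if `v` is
essentially bounded on a backward cylinder `Q(z₁, ϱ) ⊆ Q`, then on it `v` has a representative `V`
with `C^∞` slices, all of whose spatial derivatives `D_xⁿ V` are uniformly Hölder continuous on
every `Q(z₁, r)`, `0 < r < ϱ` — up to the top time (higher interior regularity of bounded solutions,
`NSBoundedHigherRegularity_holds`, Seregin–Šverák 2009 §2; the paper's
"`v ∈ C([-δ², 0]; C³(𝒞̄((0, h₁), δ)))` at least").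
[cite: Seregin2022LocalAxisym, §2 Step 1; SereginSverak2009 §2 p. 8] -/
theorem exists_smooth_representative
    (hsw : IsSuitableWeakSolutionOn (parCylOpens 0 1) 1 0 u p)
    (hp : ∫⁻ z in parCyl 0 1, ‖p z.1 z.2‖ₑ ^ (3 / 2 : ℝ) < ∞)
    {z₁ : ℝ × EuclideanSpace ℝ (Fin 3)} {ϱ : ℝ}
    (hQ : parabolicCylinder ϱ z₁ ⊆ parCyl 0 1)
    (hbdd : eLpNorm (uncurry u) ∞ (volume.restrict (parabolicCylinder ϱ z₁)) < ∞) :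
    ∃ V : ℝ → EuclideanSpace ℝ (Fin 3) → EuclideanSpace ℝ (Fin 3),
      uncurry u =ᵐ[volume.restrict (parabolicCylinder ϱ z₁)] uncurry V ∧
      (∀ w ∈ parabolicCylinder ϱ z₁, ContDiffAt ℝ (⊤ : ℕ∞) (V w.1) w.2) ∧
      ∀ n : ℕ, ∀ r ∈ Ioo 0 ϱ, ∃ C α : ℝ≥0, 0 < α ∧
        HolderOnWith C α
          (fun w : ℝ × EuclideanSpace ℝ (Fin 3) => iteratedFDeriv ℝ n (V w.1) w.2)
          (parabolicCylinder r z₁) := by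
  have hle : parabolicCylinderOpens ϱ z₁ ≤ parCylOpens 0 1 := fun w hw => hQ hw
  have hM : ∀ᵐ w ∂(volume.restrict (parabolicCylinder ϱ z₁)),
      ‖u w.1 w.2‖ ≤ (eLpNorm (uncurry u) ∞ (volume.restrict (parabolicCylinder ϱ z₁))).toReal := by
    filter_upwards [ae_le_eLpNormEssSup (f := uncurry u)
      (μ := volume.restrict (parabolicCylinder ϱ z₁))] with w hw
    rw [← eLpNorm_exponent_top] at hw
    have := ENNReal.toReal_mono hbdd.ne hw
    rwa [toReal_enorm] at this
  have hpϱ : ∫⁻ w in parabolicCylinder ϱ z₁, ‖p w.1 w.2‖ₑ ^ (3 / 2 : ℝ) < ∞ :=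
    (lintegral_mono_set hQ).trans_lt hp
  exact NSBoundedHigherRegularity_holds u p z₁ ϱ _ (hsw.of_le hle).distributional hM hpϱ

end Seregin2022

end Literature.Analysis.FluidPDE
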